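import Summits.ResolutionOfSingularities.ResolutionOfSingularities.Theorems.FrobeniusClosingPatchingRelPerfectDepthTaylorFlagAffine
import HarnessLib

/-!
# Crux `PatchingRelPerfect` (stmt-ResolutionOfSingularities-16161), chain W5.2 — depth-`ℓ` programme beyond the graded case,
# GLUE G2′: the coefficient flag of a retraction pair with PRINCIPAL kernel is the family of coefficient ideals of the
# pulled-back polynomial ideal — no bundle structure needed (lead prover, gen 4)

[OURS · L1 W5.2 · lead] Replaces the role of NO printed item; NOT a statement of the manuscript under review.

The chain's retraction `r : V ⟶ E` (res-D-pv-055's `R₀` on `Bl_𝔪 Spec S`, charts `S[𝔪/x_j] ⊇ κ₀[x/x_j]`) is NOT an `𝔸¹`-bundle: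
`S[𝔪/x_j] ⊋ κ₀[x/x_j][x_j]`. What every affine retraction pair of rings `φk : R → A`, `φr : A → R` (`φk ∘ φr = id`) with
principal kernel `ker φk = (t₀)` DOES satisfy is the truncated identity `R = ψ(A[t]) + t₀^ℓ R` for the comparison map
`ψ = eval₂RingHom φr t₀ : A[t] → R` (`t ↦ t₀`), and that is all the coefficient flag needs, because a depth-`ℓ` residual ideal
contains `t₀^ℓ`. This file proves, for `J ⊆ R` with `t₀^ℓ ∈ J` and `𝔎 := ψ⁻¹ J ⊆ A[t]`:

* `map_eq_coeffIdeal_comap` — `φk(J) = coeffIdeal 𝔎 0`;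
* `comap_taylorShiftRing` — `ψ⁻¹ (taylorShiftRing φk φr J) = taylorShiftRing constantCoeff C 𝔎` (the abstract shift pulls back to the
  polynomial shift), and its iterate;
* **`coeffFlagRing_eq_coeffIdeal_comap` — `coeffFlagRing φk φr a J = coeffIdeal 𝔎 a`**: with `ideal_top_coeffFlag` (p512387) the abstract
  coefficient flag `coeffFlag k r a K` (p507375) of the chain's residual ideal on any affine retraction chart is LITERALLY the family of
  coefficient ideals of p508112 (`ideal_top_coeffFlag_eq_coeffIdeal_comap`);
* the CONVERSE permissibility transfer at ring level, `coeff_mem_pow_of_mem_centrePow` / `le_centrePow_iff`: `𝔎 ≤ (C·A[t] + (t))^ℓ ⟺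
  ∀ b < ℓ, coeffIdeal 𝔎 b ≤ C^{ℓ−b}` (tri-1 TRIAGE v9 A1: «the converse is not yet typed» — now it is).

Fact-free; AI-written, weaker than expert review. The chart PROPAGATION square (G3: `β ∘ ψ = ψ′ ∘ substStep` ⇒ `ψ′⁻¹K′ = ((ψ⁻¹K)·A′[t′] : z^ℓ)`,
then `coeffIdeal_transform_eq`) is the next object.

References: H. Kawanoue, K. Matsuki, Adv. Stud. Pure Math. 70 (2016), §2 [KawanoueMatsuki2016]; E. Bierstone, D. Grigoriev, P. Milman,
J. Włodarczyk, arXiv:1206.3090, §3.2 [BierstoneGrigorievMilmanWlodarczyk2011].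
-/

-- `Summit.<Summit>.<Sub>.Theorems` with `Sub = Summit` (single-conjunct summit, D-0017)
set_option linter.dupNamespace false

noncomputable section

open Polynomial CategoryTheory AlgebraicGeometry TopologicalSpace
open Literature.AlgebraicGeometry.Resolution

namespace Summit.ResolutionOfSingularities.ResolutionOfSingularities.Theorems

universe u

namespace DepthGraded.Taylor

/-! ## §1 The converse permissibility transfer (ring level) -/

section Converse

variable {B : Type u} [CommRing B]

/-- Products respect the weighted coefficient condition: if `coeff_b s ∈ C^{m−b}` and `coeff_b r ∈ C^{n−b}` for all `b`, then
`coeff_b (s·r) ∈ C^{m+n−b}` for all `b`. [folklore] -/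
theorem coeff_mul_mem_pow_of_coeff_mem_pow {C : Ideal B} {m n : ℕ} {s r : B[X]}
    (hs : ∀ b, s.coeff b ∈ C ^ (m - b)) (hr : ∀ b, r.coeff b ∈ C ^ (n - b)) (b : ℕ) :
    (s * r).coeff b ∈ C ^ (m + n - b) := by
  rw [Polynomial.coeff_mul]
  refine Submodule.sum_mem _ fun ij hij => ?_
  have hb : ij.1 + ij.2 = b := Finset.mem_antidiagonal.mp hij
  have h := Ideal.mul_mem_mul (hs ij.1) (hr ij.2)
  rw [← pow_add] at h
  exact Ideal.pow_le_pow_right (by omega) h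

/-- [OURS · L1 W5.2 · lead] **Coefficients of the members of `Ĉ^ℓ`**, `Ĉ = C·B[t] + (t)`: `coeff_b p ∈ C^{ℓ−b}`. The converse of
`le_pow_of_coeff_mem_pow` (p508112). [folklore] -/
theorem coeff_mem_pow_of_mem_centrePow {C : Ideal B} :
    ∀ {ℓ : ℕ} {p : B[X]}, p ∈ (C.map (Polynomial.C : B →+* B[X]) ⊔ Ideal.span {(X : B[X])}) ^ ℓ →
      ∀ b : ℕ, p.coeff b ∈ C ^ (ℓ - b)
  | 0, p, _, b => by rw [Nat.zero_sub, pow_zero, Ideal.one_eq_top]; exact Submodule.mem_top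
  | ℓ + 1, p, hp, b => by
    rw [pow_succ] at hp
    revert b
    refine Submodule.mul_induction_on hp (fun s hs r hr => ?_) (fun x y hx hy b => ?_)
    · -- generators: `s ∈ Ĉ^ℓ`, `r ∈ Ĉ`
      have hs' : ∀ b, s.coeff b ∈ C ^ (ℓ - b) := coeff_mem_pow_of_mem_centrePow hs
      have hr' : ∀ b, r.coeff b ∈ C ^ (1 - b) := by
        intro b
        obtain ⟨r₁, hr₁, r₂, hr₂, rfl⟩ := Submodule.mem_sup.mp hr
        rw [Polynomial.coeff_add]
        refine Submodule.add_mem _ ?_ ?_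
        · have h1 := Ideal.mem_map_C_iff.mp hr₁ b
          cases b with
          | zero => rw [Nat.sub_zero, pow_one]; exact h1
          | succ b => rw [Nat.sub_eq_zero_of_le (by omega), pow_zero, Ideal.one_eq_top]; exact Submodule.mem_top
        · obtain ⟨g, rfl⟩ := Ideal.mem_span_singleton'.mp hr₂
          cases b with
          | zero => rw [Polynomial.coeff_mul_X_zero]; exact Submodule.zero_mem _
          | succ b => rw [Nat.sub_eq_zero_of_le (by omega), pow_zero, Ideal.one_eq_top]; exact Submodule.mem_top
      exact coeff_mul_mem_pow_of_coeff_mem_pow hs' hr'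
    · rw [Polynomial.coeff_add]
      exact Submodule.add_mem _ (hx b) (hy b)

/-- [OURS · L1 W5.2 · lead] **Permissibility ⟺ flag condition** (ring level): `𝔎 ≤ (C·B[t] + (t))^ℓ ⟺ coeffIdeal 𝔎 b ≤ C^{ℓ−b}` for
all `b < ℓ` (DESIGN NOTE §1 (a) / tri-1 TRIAGE v9 A1: «`K ≤ 𝓘_Z^ℓ ⟺ R_n ≤ 𝓘_{Z,E}^n ∀ n`»). [cite: KawanoueMatsuki2016, §2] -/
theorem le_centrePow_iff {𝔎 : Ideal B[X]} {C : Ideal B} {ℓ : ℕ} :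
    𝔎 ≤ (C.map (Polynomial.C : B →+* B[X]) ⊔ Ideal.span {(X : B[X])}) ^ ℓ ↔
      ∀ b < ℓ, coeffIdeal 𝔎 b ≤ C ^ (ℓ - b) := by
  constructor
  · intro h b _ c hc
    obtain ⟨p, hp, rfl⟩ := mem_coeffIdeal_iff.mp hc
    exact coeff_mem_pow_of_mem_centrePow (h hp) b
  · intro h
    exact le_pow_of_coeff_mem_pow fun p hp b hb => h b hb (coeff_mem_coeffIdeal hp b)

end Converse

/-! ## §2 Retraction pairs of rings with principal kernel: the comparison map `ψ : A[t] → R` -/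

section Comap

variable {R A : Type u} [CommRing R] [CommRing A] (φk : R →+* A) (φr : A →+* R) (t₀ : R)
  (hkr : ∀ a, φk (φr a) = a) (hker : RingHom.ker φk = Ideal.span {t₀})

include hkr in
/-- `φk ∘ ψ = constantCoeff`: `φk (ψ p) = coeff₀ p` (`φk ∘ φr = id`, `φk t₀ = 0`). [folklore] -/
theorem apply_eval₂RingHom_eq_coeff_zero (hkt : φk t₀ = 0) (p : A[X]) :
    φk (Polynomial.eval₂RingHom φr t₀ p) = p.coeff 0 := by
  have hid : φk.comp φr = RingHom.id A := RingHom.ext hkr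
  rw [Polynomial.coe_eval₂RingHom, Polynomial.hom_eval₂, hid, hkt, Polynomial.eval₂_id,
    Polynomial.coeff_zero_eq_eval_zero]

include hker in
/-- `φk t₀ = 0`. [folklore] -/
theorem apply_generator_eq_zero : φk t₀ = 0 := by
  rw [← RingHom.mem_ker, hker]
  exact Ideal.mem_span_singleton_self _

include hkr hker in
/-- **The truncated identity `R = ψ(A[t]) + t₀^ℓ·R`**: every `s ∈ R` is `ψ q + t₀^ℓ u` (induction on `ℓ`: `u − φr(φk u) ∈ ker φk =
(t₀)`). This replaces the (false in general) `𝔸¹`-bundle structure. [folklore] -/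
theorem exists_eq_eval₂_add_pow_mul (ℓ : ℕ) (s : R) :
    ∃ (q : A[X]) (u : R), s = Polynomial.eval₂RingHom φr t₀ q + t₀ ^ ℓ * u := by
  induction ℓ with
  | zero => exact ⟨0, s, by rw [map_zero, pow_zero, one_mul, zero_add]⟩
  | succ ℓ ih =>
    obtain ⟨q, u, hs⟩ := ih
    have hu : u - φr (φk u) ∈ RingHom.ker φk := by
      rw [RingHom.mem_ker, map_sub, hkr, sub_self]
    rw [hker, Ideal.mem_span_singleton'] at hu
    obtain ⟨u', hu'⟩ := hu
    refine ⟨q + Polynomial.C (φk u) * X ^ ℓ, u', ?_⟩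
    rw [map_add, map_mul, map_pow, Polynomial.coe_eval₂RingHom, Polynomial.eval₂_C, Polynomial.eval₂_X,
      ← Polynomial.coe_eval₂RingHom, hs]
    linear_combination (-(t₀ ^ ℓ)) * hu'

include hkr hker in
/-- Elements of `φr(I)·R` decompose as `ψ g + t₀^m u` with `g ∈ I·A[t]`. [folklore] -/
theorem exists_eq_eval₂_add_pow_mul_of_mem_map (I : Ideal A) (m : ℕ) {w : R} (hw : w ∈ I.map φr) :
    ∃ g ∈ I.map (Polynomial.C : A →+* A[X]), ∃ u : R, w = Polynomial.eval₂RingHom φr t₀ g + t₀ ^ m * u := by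
  refine Submodule.span_induction (p := fun w _ => ∃ g ∈ I.map (Polynomial.C : A →+* A[X]), ∃ u : R,
      w = Polynomial.eval₂RingHom φr t₀ g + t₀ ^ m * u) ?_ ?_ ?_ ?_ hw
  · rintro _ ⟨c, hc, rfl⟩
    exact ⟨Polynomial.C c, Ideal.mem_map_of_mem _ hc, 0, by
      rw [Polynomial.coe_eval₂RingHom, Polynomial.eval₂_C, mul_zero, add_zero]⟩
  · exact ⟨0, Submodule.zero_mem _, 0, by rw [map_zero, mul_zero, add_zero]⟩
  · rintro x y - - ⟨g₁, hg₁, u₁, rfl⟩ ⟨g₂, hg₂, u₂, rfl⟩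
    exact ⟨g₁ + g₂, Submodule.add_mem _ hg₁ hg₂, u₁ + u₂, by rw [map_add, mul_add]; abel⟩
  · rintro s w - ⟨g, hg, u, rfl⟩
    obtain ⟨σ, v, hs⟩ := exists_eq_eval₂_add_pow_mul φk φr t₀ hkr hker m s
    refine ⟨σ * g, Ideal.mul_mem_left _ _ hg, v * Polynomial.eval₂RingHom φr t₀ g + s * u, ?_⟩
    rw [smul_eq_mul, hs, map_mul]
    ring

include hkr hker in
/-- [OURS · L1 W5.2 · lead] **`φk(J) = coeffIdeal (ψ⁻¹J) 0`** for `J ∋ t₀^ℓ`: the restriction of `J` to `W` is the ideal of constant terms of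
the pulled-back polynomial ideal. [cite: KawanoueMatsuki2016, §2] -/
theorem map_eq_coeffIdeal_comap {J : Ideal R} {ℓ : ℕ} (hJ : t₀ ^ ℓ ∈ J) :
    J.map φk = coeffIdeal (J.comap (Polynomial.eval₂RingHom φr t₀)) 0 := by
  have hkt : φk t₀ = 0 := apply_generator_eq_zero φk t₀ hker
  have hsurj : Function.Surjective φk := fun a => ⟨φr a, hkr a⟩
  apply le_antisymm
  · intro c hc
    obtain ⟨j, hj, rfl⟩ := (Ideal.mem_map_iff_of_surjective φk hsurj).mp hc
    obtain ⟨q, u, hjq⟩ := exists_eq_eval₂_add_pow_mul φk φr t₀ hkr hker (ℓ + 1) j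
    have hq : Polynomial.eval₂RingHom φr t₀ q ∈ J := by
      rw [eq_sub_of_add_eq hjq.symm]
      exact Submodule.sub_mem _ hj (Ideal.mul_mem_right _ _ (by rw [pow_succ]; exact Ideal.mul_mem_right _ _ hJ))
    refine mem_coeffIdeal_iff.mpr ⟨q, hq, ?_⟩
    rw [hjq, map_add, map_mul, map_pow, hkt, zero_pow (Nat.succ_ne_zero ℓ), zero_mul, add_zero,
      apply_eval₂RingHom_eq_coeff_zero φk φr t₀ hkr hkt]
  · intro c hc
    obtain ⟨p, hp, rfl⟩ := mem_coeffIdeal_iff.mp hc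
    rw [← apply_eval₂RingHom_eq_coeff_zero φk φr t₀ hkr hkt]
    exact Ideal.mem_map_of_mem _ hp

include hkr hker in
/-- [OURS · L1 W5.2 · lead] **The abstract Taylor shift pulls back to the polynomial Taylor shift**:
`ψ⁻¹ (taylorShiftRing φk φr J) = taylorShiftRing constantCoeff C (ψ⁻¹ J)` for `J ∋ t₀^ℓ`. [cite: KawanoueMatsuki2016, §2] -/
theorem comap_taylorShiftRing {J : Ideal R} {ℓ : ℕ} (hJ : t₀ ^ ℓ ∈ J) :
    (taylorShiftRing φk φr J).comap (Polynomial.eval₂RingHom φr t₀) =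
      taylorShiftRing (Polynomial.constantCoeff : A[X] →+* A) Polynomial.C (J.comap (Polynomial.eval₂RingHom φr t₀)) := by
  set ψ := Polynomial.eval₂RingHom φr t₀ with hψ
  have hψX : ψ X = t₀ := by rw [hψ, Polynomial.coe_eval₂RingHom, Polynomial.eval₂_X]
  have hψC : ψ.comp Polynomial.C = φr := RingHom.ext fun a => by
    rw [RingHom.comp_apply, hψ, Polynomial.coe_eval₂RingHom, Polynomial.eval₂_C]
  have h0 : J.map φk = (J.comap ψ).map Polynomial.constantCoeff := by
    rw [map_eq_coeffIdeal_comap φk φr t₀ hkr hker hJ, map_constantCoeff_eq_coeffIdeal]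
  ext q
  rw [Ideal.mem_comap, taylorShiftRing, taylorShiftRing, hker, Polynomial.ker_constantCoeff,
    Ideal.mem_colon_span_singleton, Ideal.mem_colon_span_singleton, Ideal.mem_inf, Ideal.mem_inf, ← h0]
  constructor
  · rintro ⟨h1, -⟩
    refine ⟨?_, Ideal.mul_mem_left _ _ (Ideal.mem_span_singleton_self _)⟩
    obtain ⟨j, hj, w, hw, hjw⟩ := Submodule.mem_sup.mp h1
    obtain ⟨g, hg, u, rfl⟩ := exists_eq_eval₂_add_pow_mul_of_mem_map φk φr t₀ hkr hker (J.map φk) (ℓ + 1) hw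
    -- `ψ (q·t − g) = j + t₀^{ℓ+1} u ∈ J`
    have hmem : q * X - g ∈ J.comap ψ := by
      rw [Ideal.mem_comap, map_sub, map_mul, hψX]
      have : ψ q * t₀ - ψ g = j + t₀ ^ (ℓ + 1) * u := by rw [← hjw]; ring
      rw [this]
      exact Submodule.add_mem _ hj (by rw [pow_succ, mul_assoc]; exact Ideal.mul_mem_right _ _ hJ)
    have hq : q * X = (q * X - g) + g := by ring
    rw [hq]
    exact Submodule.add_mem _ (Ideal.mem_sup_left hmem) (Ideal.mem_sup_right hg)
  · rintro ⟨h1, -⟩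
    refine ⟨?_, ?_⟩
    · have h2 := Ideal.mem_map_of_mem ψ h1
      rw [map_mul, hψX, Ideal.map_sup, Ideal.map_map, hψC] at h2
      have hle : (J.comap ψ).map ψ ⊔ (J.map φk).map φr ≤ J ⊔ (J.map φk).map φr :=
        sup_le_sup_right Ideal.map_comap_le _
      exact hle h2
    · exact Ideal.mul_mem_left _ _ (Ideal.mem_span_singleton_self _)

include hker in
/-- The shift keeps a power of the generator: `t₀^ℓ ∈ J ⇒ t₀^{ℓ−1} ∈ taylorShiftRing φk φr J`. [folklore] -/
theorem pow_mem_taylorShiftRing {J : Ideal R} {ℓ : ℕ} (hJ : t₀ ^ ℓ ∈ J) :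
    t₀ ^ (ℓ - 1) ∈ taylorShiftRing φk φr J := by
  rw [taylorShiftRing, hker, Ideal.mem_colon_span_singleton]
  refine ⟨Ideal.mem_sup_left ?_, Ideal.mul_mem_left _ _ (Ideal.mem_span_singleton_self _)⟩
  cases ℓ with
  | zero =>
    rw [pow_zero] at hJ
    exact Ideal.mul_mem_right _ _ (by simpa using hJ)
  | succ ℓ => rw [Nat.add_sub_cancel, ← pow_succ]; exact hJ

include hkr hker in
/-- The iterated abstract shift pulls back to the iterated polynomial shift (and keeps `t₀^{ℓ−a}`). [folklore] -/
theorem comap_taylorShiftRingIter (a : ℕ) :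
    ∀ {J : Ideal R} {ℓ : ℕ}, t₀ ^ ℓ ∈ J →
      (taylorShiftRingIter φk φr a J).comap (Polynomial.eval₂RingHom φr t₀) =
          taylorShiftRingIter (Polynomial.constantCoeff : A[X] →+* A) Polynomial.C a
            (J.comap (Polynomial.eval₂RingHom φr t₀)) ∧
        t₀ ^ (ℓ - a) ∈ taylorShiftRingIter φk φr a J := by
  induction a with
  | zero => intro J ℓ hJ; exact ⟨rfl, by rw [Nat.sub_zero]; exact hJ⟩
  | succ a ih =>
    intro J ℓ hJ
    have h1 := pow_mem_taylorShiftRing φk φr t₀ hker hJ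
    obtain ⟨h2, h3⟩ := ih h1
    refine ⟨?_, ?_⟩
    · rw [taylorShiftRingIter_succ, taylorShiftRingIter_succ, h2, comap_taylorShiftRing φk φr t₀ hkr hker hJ]
    · rw [taylorShiftRingIter_succ, Nat.sub_add_eq, Nat.sub_right_comm]
      exact h3

include hkr hker in
/-- [OURS · L1 W5.2 · lead] **GLUE G2′ — the abstract coefficient flag of a retraction pair with principal kernel is the family of
coefficient ideals of the pulled-back polynomial ideal**: for `φk ∘ φr = id`, `ker φk = (t₀)`, `ψ = eval₂RingHom φr t₀ : A[t] → R`
and `J ∋ t₀^ℓ`, `coeffFlagRing φk φr a J = coeffIdeal (ψ⁻¹ J) a` for every `a`. [cite: KawanoueMatsuki2016, §2] -/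
theorem coeffFlagRing_eq_coeffIdeal_comap {J : Ideal R} {ℓ : ℕ} (hJ : t₀ ^ ℓ ∈ J) (a : ℕ) :
    coeffFlagRing φk φr a J = coeffIdeal (J.comap (Polynomial.eval₂RingHom φr t₀)) a := by
  obtain ⟨h1, h2⟩ := comap_taylorShiftRingIter φk φr t₀ hkr hker a hJ
  rw [coeffFlagRing, map_eq_coeffIdeal_comap φk φr t₀ hkr hker h2, h1, coeffIdeal_taylorShiftRingIter, Nat.zero_add]

end Comap

end DepthGraded.Taylor

/-! ## §3 Affine retraction charts of the chain: the abstract flag is `coeffIdeal` of the pulled-back ideal -/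

namespace DepthGraded

section AffineChart

variable {W V : Scheme.{u}} [IsAffine W] [IsAffine V] (k : W ⟶ V) (r : V ⟶ W)

/-- [OURS · L1 W5.2 · lead] **GLUE G2′ on an affine retraction chart** (`k ≫ r = 𝟙`, `V`, `W` affine, `ker k.appTop = (t)` principal —
the chain's charts `Spec S[𝔪/x_j] ⊇ E ∩ D₊(x_j)` with `t = x_j`, and their successors): for every ideal sheaf `J` on `V` whose global
sections contain `t^ℓ`, the global sections of the abstract coefficient flag are the coefficient ideals of the polynomial ideal
`ψ⁻¹(J(⊤)) ⊆ Γ(W)[t]`, `ψ = eval₂RingHom r.appTop t`: `(coeffFlag k r a J)(⊤) = coeffIdeal (ψ⁻¹(J(⊤))) a`. No bundle structure, no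
flatness of `r` is used. [cite: KawanoueMatsuki2016, §2] -/
theorem ideal_top_coeffFlag_eq_coeffIdeal_comap (hkr : k ≫ r = 𝟙 W) (t : Γ(V, ⊤))
    (hker : RingHom.ker k.appTop.hom = Ideal.span {t}) (J : V.IdealSheafData) {ℓ : ℕ}
    (hJ : t ^ ℓ ∈ J.ideal ⟨⊤, isAffineOpen_top V⟩) (a : ℕ) :
    (coeffFlag k r a J).ideal ⟨⊤, isAffineOpen_top W⟩ =
      Taylor.coeffIdeal ((J.ideal ⟨⊤, isAffineOpen_top V⟩).comap (Polynomial.eval₂RingHom r.appTop.hom t)) a := by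
  have hk : (RingHom.ker k.appTop.hom).FG := by
    rw [hker]
    exact ⟨{t}, by rw [Finset.coe_singleton]⟩
  have hkr' : ∀ b : Γ(W, ⊤), k.appTop.hom (r.appTop.hom b) = b := fun b => by
    rw [← CommRingCat.comp_apply, ← Scheme.Hom.comp_appTop, hkr, Scheme.Hom.id_appTop, CommRingCat.id_apply]
  rw [ideal_top_coeffFlag k r hk, Taylor.coeffFlagRing_eq_coeffIdeal_comap k.appTop.hom r.appTop.hom t hkr' hker hJ]

end AffineChart

end DepthGraded

end Summit.ResolutionOfSingularities.ResolutionOfSingularities.Theorems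

end
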